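import Summits.BirchSwinnertonDyer.BirchSwinnertonDyer.Theses.PrintCf2
import Summits.BirchSwinnertonDyer.Rank1Residual.P2.KrizLiTwoFortyThreeSlices
import HarnessLib

/-!
# Route PrintCf2 — crux `InertOddHeegnerJOfFacts` (stmt-BirchSwinnertonDyer-20672): its two REGISTERED stubs and
# its named residual after everything in print (only Creutz–Miller, `N < 5000`), EXACT
# (helper `--supports stmt-BirchSwinnertonDyer-20672`; cell `bsd-print-cf2`, D-0131 (2) PRINT TIER, seat p4)

HONEST FRAMING (cell `bsd-print-cf2`; leaf `WAllCornerFTwo` OPEN AS A CLASS). Crux 20672 is the odd-Heegner piece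
of the inert type: relative to 𝔅_inert, `BSD(W,2)` for every globally minimal `W` with `ord_{s=1} L = 1` and
`j ∈ {−32768, −884736, −884736000, −147197952000, −262537412640768000}` (the twists of `121b1`, `361a1`,
`1849a1`, `4489a1`, `26569a1`; CM by `ℚ(√−11)`, …, `ℚ(√−163)`, `2` inert). Its birth skeleton (planner g2) cuts
it by reduction at `2` (`stub_inertOddHeegner_goodAtTwo` / `…_badAtTwo`). PRINT ON THIS CLASS (lit DOSSIER §15.4,
of record): both `2`-adic transport doors are structurally void (Kriz–Li's (★) fails — `c_q = 2` at the CM prime;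
Shu–Zhai needs rational `2`-torsion), so the ONLY printed theorem meeting the class is Creutz–Miller 2012 /
Miller 2011 / Miller–Stoll 2013 BY NAME (`bsdTriple_of_analyticRank_le_one_of_conductor_lt`: full BSD for
`r_an ≤ 1`, `N < 5000`; route aside `SmallConductorOfFacts` = stmt-BirchSwinnertonDyer-20770, CLOSED). This
file books that in the kernel, nothing more: §1 the crux ⟺ its two registered stubs (pure logic); §2 granted
S31, the crux (and each stub) ⟺ the same statement restricted to CONDUCTOR `≥ 5000` — THE NAMED RESIDUAL OF
CRUX 20672, EXACT. Nothing is asserted; no fact introduced; beyond-print theorem: NO.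
[cite: CreutzMiller2012, Thm. 1.1] [cite: KrizLi2019, Thm. 1.12 and Ex. 6.2] [cite: ShuZhai2021, Thm. 1.2 (hypothesis (Tor))]
[cite: Miller2011LMS, Def. 1.1]
-/

-- single-conjunct summit: `Summit.BirchSwinnertonDyer.BirchSwinnertonDyer.…` repeats the name by design
set_option linter.dupNamespace false

open WeierstrassCurve Literature.NumberTheory.EllipticCurves Literature.NumberTheory.EllipticCurves.Rank1Residual
  Literature.NumberTheory.EllipticCurves.ShuZhai2021 Literature.NumberTheory.EllipticCurves.KrizLi2019

namespace Summit.BirchSwinnertonDyer.PrintCf2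

/-! ## §1 The crux ⟺ its two registered stubs (excluded middle on `Good W 2`) -/

/-- **Crux 20672 splits EXACTLY into its two registered stubs** `stub_inertOddHeegner_goodAtTwo` /
`stub_inertOddHeegner_badAtTwo` (pure logic). [folklore] -/
theorem inertOddHeegnerJOfFacts_iff_stubs :
    Summit.BirchSwinnertonDyer.BirchSwinnertonDyer.Theses.PrintCf2.InertOddHeegnerJOfFacts ↔
      ((rank_eq_analyticRank_of_analyticRank_le_one ∧ hasEntireLFunction_rat ∧
        bsdRHS_eq_of_isIsogenous ∧ bsdTriple_of_hasCM_of_L_one_ne_zero ∧ thm112_bsdTwo_twist ∧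
        thm12_ranks_of_twists ∧ thm14_twoPartBSD_of_twists ∧ thm410_twoAdicValuations_of_twists) →
        ∀ (W : WeierstrassCurve ℚ) [W.IsElliptic] [W.IsGloballyMinimal], W.analyticRank = 1 →
          (W.j = -32768 ∨ W.j = -884736 ∨ W.j = -884736000 ∨ W.j = -147197952000 ∨
            W.j = -262537412640768000) → Good W 2 → BSDp W 2) ∧
      ((rank_eq_analyticRank_of_analyticRank_le_one ∧ hasEntireLFunction_rat ∧
        bsdRHS_eq_of_isIsogenous ∧ bsdTriple_of_hasCM_of_L_one_ne_zero ∧ thm112_bsdTwo_twist ∧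
        thm12_ranks_of_twists ∧ thm14_twoPartBSD_of_twists ∧ thm410_twoAdicValuations_of_twists) →
        ∀ (W : WeierstrassCurve ℚ) [W.IsElliptic] [W.IsGloballyMinimal], W.analyticRank = 1 →
          (W.j = -32768 ∨ W.j = -884736 ∨ W.j = -884736000 ∨ W.j = -147197952000 ∨
            W.j = -262537412640768000) → ¬ Good W 2 → BSDp W 2) := by
  unfold Summit.BirchSwinnertonDyer.BirchSwinnertonDyer.Theses.PrintCf2.InertOddHeegnerJOfFacts
  constructor
  · intro h
    exact ⟨fun hB W _ _ hr hj _ => h hB W hr hj, fun hB W _ _ hr hj _ => h hB W hr hj⟩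
  · rintro ⟨hG, hBd⟩ hB W _ _ hr hj
    by_cases hg : Good W 2
    · exact hG hB W hr hj hg
    · exact hBd hB W hr hj hg

/-! ## §2 After the only print on the class (`N < 5000`, Creutz–Miller BY NAME): the residual, EXACT -/

/-- **THE NAMED RESIDUAL OF CRUX 20672 IN THE KERNEL, EXACT.** Granted Creutz–Miller / Miller / Miller–Stoll
BY NAME (`hS31`: full BSD for `r_an ≤ 1`, `N < 5000`; `P2.bsdp_two_of_analyticRank_le_one_of_conductor_lt_5000`),
route item `InertOddHeegnerJOfFacts` holds IFF its statement restricted to CONDUCTOR `≥ 5000` holds — nothing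
else is in print on the five odd-Heegner twist families (DOSSIER §15.4: both `2`-adic transport doors void).
[cite: CreutzMiller2012, Thm. 1.1] [cite: Miller2011LMS, Thm. 1.2 and Def. 1.1] [cite: KrizLi2019, Ex. 6.2] -/
theorem inertOddHeegnerJOfFacts_iff_largeConductor_of_S31
    (hS31 : bsdTriple_of_analyticRank_le_one_of_conductor_lt) :
    Summit.BirchSwinnertonDyer.BirchSwinnertonDyer.Theses.PrintCf2.InertOddHeegnerJOfFacts ↔
      ((rank_eq_analyticRank_of_analyticRank_le_one ∧ hasEntireLFunction_rat ∧
        bsdRHS_eq_of_isIsogenous ∧ bsdTriple_of_hasCM_of_L_one_ne_zero ∧ thm112_bsdTwo_twist ∧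
        thm12_ranks_of_twists ∧ thm14_twoPartBSD_of_twists ∧ thm410_twoAdicValuations_of_twists) →
        ∀ (W : WeierstrassCurve ℚ) [W.IsElliptic] [W.IsGloballyMinimal], W.analyticRank = 1 →
          (W.j = -32768 ∨ W.j = -884736 ∨ W.j = -884736000 ∨ W.j = -147197952000 ∨
            W.j = -262537412640768000) → 5000 ≤ W.conductorNorm ℤ → BSDp W 2) := by
  unfold Summit.BirchSwinnertonDyer.BirchSwinnertonDyer.Theses.PrintCf2.InertOddHeegnerJOfFacts
  constructor
  · exact fun h hB W _ _ hr hj _ => h hB W hr hj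
  · intro h hB W _ _ hr hj
    by_cases hN : W.conductorNorm ℤ < 5000
    · exact Rank1Residual.P2.bsdp_two_of_analyticRank_le_one_of_conductor_lt_5000 hS31 W hr.le hN
    · exact h hB W hr hj (not_lt.mp hN)

/-- **The two registered stubs of crux 20672 after print, EXACT** (granted `hS31`): each stub ⟺ its restriction
to conductor `≥ 5000`. [cite: CreutzMiller2012, Thm. 1.1] [cite: Miller2011LMS, Def. 1.1] -/
theorem stubs_inertOddHeegner_iff_largeConductor_of_S31
    (hS31 : bsdTriple_of_analyticRank_le_one_of_conductor_lt) :
    (((rank_eq_analyticRank_of_analyticRank_le_one ∧ hasEntireLFunction_rat ∧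
        bsdRHS_eq_of_isIsogenous ∧ bsdTriple_of_hasCM_of_L_one_ne_zero ∧ thm112_bsdTwo_twist ∧
        thm12_ranks_of_twists ∧ thm14_twoPartBSD_of_twists ∧ thm410_twoAdicValuations_of_twists) →
        ∀ (W : WeierstrassCurve ℚ) [W.IsElliptic] [W.IsGloballyMinimal], W.analyticRank = 1 →
          (W.j = -32768 ∨ W.j = -884736 ∨ W.j = -884736000 ∨ W.j = -147197952000 ∨
            W.j = -262537412640768000) → Good W 2 → BSDp W 2) ↔
      ((rank_eq_analyticRank_of_analyticRank_le_one ∧ hasEntireLFunction_rat ∧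
        bsdRHS_eq_of_isIsogenous ∧ bsdTriple_of_hasCM_of_L_one_ne_zero ∧ thm112_bsdTwo_twist ∧
        thm12_ranks_of_twists ∧ thm14_twoPartBSD_of_twists ∧ thm410_twoAdicValuations_of_twists) →
        ∀ (W : WeierstrassCurve ℚ) [W.IsElliptic] [W.IsGloballyMinimal], W.analyticRank = 1 →
          (W.j = -32768 ∨ W.j = -884736 ∨ W.j = -884736000 ∨ W.j = -147197952000 ∨
            W.j = -262537412640768000) → 5000 ≤ W.conductorNorm ℤ → Good W 2 → BSDp W 2)) ∧
    (((rank_eq_analyticRank_of_analyticRank_le_one ∧ hasEntireLFunction_rat ∧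
        bsdRHS_eq_of_isIsogenous ∧ bsdTriple_of_hasCM_of_L_one_ne_zero ∧ thm112_bsdTwo_twist ∧
        thm12_ranks_of_twists ∧ thm14_twoPartBSD_of_twists ∧ thm410_twoAdicValuations_of_twists) →
        ∀ (W : WeierstrassCurve ℚ) [W.IsElliptic] [W.IsGloballyMinimal], W.analyticRank = 1 →
          (W.j = -32768 ∨ W.j = -884736 ∨ W.j = -884736000 ∨ W.j = -147197952000 ∨
            W.j = -262537412640768000) → ¬ Good W 2 → BSDp W 2) ↔
      ((rank_eq_analyticRank_of_analyticRank_le_one ∧ hasEntireLFunction_rat ∧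
        bsdRHS_eq_of_isIsogenous ∧ bsdTriple_of_hasCM_of_L_one_ne_zero ∧ thm112_bsdTwo_twist ∧
        thm12_ranks_of_twists ∧ thm14_twoPartBSD_of_twists ∧ thm410_twoAdicValuations_of_twists) →
        ∀ (W : WeierstrassCurve ℚ) [W.IsElliptic] [W.IsGloballyMinimal], W.analyticRank = 1 →
          (W.j = -32768 ∨ W.j = -884736 ∨ W.j = -884736000 ∨ W.j = -147197952000 ∨
            W.j = -262537412640768000) → 5000 ≤ W.conductorNorm ℤ → ¬ Good W 2 → BSDp W 2)) := by
  have small : ∀ (W : WeierstrassCurve ℚ) [W.IsElliptic] [W.IsGloballyMinimal], W.analyticRank = 1 →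
      W.conductorNorm ℤ < 5000 → BSDp W 2 :=
    fun W _ _ hr hN => Rank1Residual.P2.bsdp_two_of_analyticRank_le_one_of_conductor_lt_5000 hS31 W hr.le hN
  refine ⟨⟨fun h hB W _ _ hr hj _ hg => h hB W hr hj hg, fun h hB W _ _ hr hj hg => ?_⟩,
    ⟨fun h hB W _ _ hr hj _ hng => h hB W hr hj hng, fun h hB W _ _ hr hj hng => ?_⟩⟩
  · by_cases hN : W.conductorNorm ℤ < 5000
    · exact small W hr hN
    · exact h hB W hr hj (not_lt.mp hN) hg
  · by_cases hN : W.conductorNorm ℤ < 5000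
    · exact small W hr hN
    · exact h hB W hr hj (not_lt.mp hN) hng

end Summit.BirchSwinnertonDyer.PrintCf2
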